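import Literature.MathematicalPhysics.QuantumManyBody.GroundStateFeynmanKacGaussian
import Literature.Probability.Process.BrownianSupTail
import Mathlib.MeasureTheory.Integral.DominatedConvergence
import HarnessLib

/-!
# Ground-state Feynman–Kac: heat-kernel continuity, exit probabilities and weight defects

Topic `Literature/MathematicalPhysics/QuantumManyBody`; theorems only. Analytic and probabilistic
estimates entering the strong Feller property / compactness of the Feynman–Kac semigroup
(Chung–Zhao (1995), Thm 2.2 and Thm 3.17) in the proof of the named fact
`Literature.MathematicalPhysics.QuantumManyBody.BoseGas.GroundStateFeynmanKac`:

* the real free heat kernel `p(2t; X, Y) = ∏ᵢ ∏ₖ gaussianPDFReal (X i k) (2t) (Y i k)` and the free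
  expectation of a real observable, `E[h(B_t)] = ∫ p(2t; X, Y) h(Y) dY` (`integral_worldLine_eq`),
  `∫ p = 1`;
* **translation continuity of the heat kernel in `L¹`** (Scheffé): `∫ |p(2t; X, ·) - p(2t; X', ·)| → 0`
  as `X' → X`, uniformly (it only depends on `X' - X`): `integral_abs_heatKernel_sub_eq`,
  `tendsto_integral_abs_heatKernel_sub`; whence the uniform modulus of continuity of the free
  semigroup on bounded observables, `|E[h(X + √2 b_t)] - E[h(X' + √2 b_t)]| ≤ ‖h‖∞ m_t(X' - X)`
  (`abs_integral_worldLine_sub_le`) — the strong Feller property of Brownian motion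
  (Chung–Zhao Thm 2.2 / Prop 3.12);
* **exit probabilities**: from a point at distance `> r` from the complement of the box, the
  probability that a world-line leaves the box before time `s` is at most `3N` one-dimensional
  running-maximum tails `P(∃ u ≤ s, r/√6 ≤ |b_u|)` (`measure_not_survives_le`), which are
  `O(s²)` (`RevuzYor` (II.1.7) form of the tree, `measure_exists_le_abs_brownian_le`);
* **weight defect**: for a bounded pair potential `v ≤ C`, `1 - w_s ≤ 𝟙{τ ≤ s} + N² C s`
  (`one_sub_toReal_fkWeight_le`), and the monotonicity in time of the `L² → L^∞` constant.

## References

* K. L. Chung, Z. Zhao, *From Brownian Motion to Schrödinger's Equation* (1995), Thm 2.2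
  (strong Feller property of `P_t^D`), Prop 3.12, Thm 3.17. [ChungZhao1995]
* D. Revuz, M. Yor, *Continuous Martingales and Brownian Motion* (1999), Ch. II (1.7).
-/

noncomputable section

namespace Literature.MathematicalPhysics.QuantumManyBody.BoseGas

open MeasureTheory ProbabilityTheory Filter Set Metric
open scoped ENNReal NNReal Topology
open Literature.Probability.Process

variable {N : ℕ}

/-! ### The real heat kernel and the free expectation of real observables -/

/-- The `[0, ∞]`-valued heat kernel read in `ℝ` is the product of the real Gaussian densities.
[folklore] -/
theorem toReal_heatKernel (X Y : Config N) (t : ℝ≥0) :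
    (∏ i, ∏ k, gaussianPDF (X i k) (2 * t) (Y i k)).toReal =
      ∏ i, ∏ k, gaussianPDFReal (X i k) (2 * t) (Y i k) := by
  rw [ENNReal.toReal_prod]
  refine Finset.prod_congr rfl fun i _ => ?_
  rw [ENNReal.toReal_prod]
  refine Finset.prod_congr rfl fun k _ => ?_
  exact toReal_gaussianPDF _

/-- The real heat kernel is nonnegative. [folklore] -/
theorem heatKernelReal_nonneg (X Y : Config N) (t : ℝ≥0) :
    0 ≤ ∏ i, ∏ k, gaussianPDFReal (X i k) (2 * t) (Y i k) :=
  Finset.prod_nonneg fun _ _ => Finset.prod_nonneg fun _ _ => gaussianPDFReal_nonneg _ _ _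

/-- The real heat kernel is measurable in `Y`. [folklore] -/
@[fun_prop]
theorem measurable_heatKernelReal (X : Config N) (t : ℝ≥0) :
    Measurable fun Y : Config N => ∏ i, ∏ k, gaussianPDFReal (X i k) (2 * t) (Y i k) := by
  refine Finset.measurable_prod _ fun i _ => Finset.measurable_prod _ fun k _ => ?_
  exact (measurable_gaussianPDFReal _ _).comp ((measurable_pi_apply k).comp
    ((WithLp.measurable_ofLp 2 _).comp (measurable_pi_apply i)))

/-- The real heat kernel is jointly continuous in `(X, Y)`. [folklore] -/
theorem continuous_heatKernelReal_uncurry (t : ℝ≥0) :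
    Continuous fun p : Config N × Config N => ∏ i, ∏ k, gaussianPDFReal (p.1 i k) (2 * t) (p.2 i k) := by
  refine continuous_finsetProd _ fun i _ => continuous_finsetProd _ fun k _ => ?_
  have h1 : Continuous fun p : Config N × Config N => p.1 i k :=
    (PiLp.continuous_apply 2 _ k).comp ((continuous_apply i).comp continuous_fst)
  have h2 : Continuous fun p : Config N × Config N => p.2 i k :=
    (PiLp.continuous_apply 2 _ k).comp ((continuous_apply i).comp continuous_snd)
  unfold gaussianPDFReal
  fun_prop

/-- The real heat kernel is symmetric in `(X, Y)`. [folklore] -/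
theorem heatKernelReal_symm (X Y : Config N) (t : ℝ≥0) :
    (∏ i, ∏ k, gaussianPDFReal (X i k) (2 * t) (Y i k)) =
      ∏ i, ∏ k, gaussianPDFReal (Y i k) (2 * t) (X i k) := by
  refine Finset.prod_congr rfl fun i _ => Finset.prod_congr rfl fun k _ => ?_
  simp only [gaussianPDFReal]
  congr 3
  ring

/-- **The free expectation of a real observable as an integral against the heat kernel**: for
measurable `h` and `t > 0`, `E[h(B_t)] = ∫ p(2t; X, Y) h(Y) dY` (Bochner; both sides are the junk
`0` when `h` is not integrable against the Gaussian law). [folklore] -/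
theorem integral_worldLine_eq (X : Config N) {t : ℝ≥0} (ht : t ≠ 0) {h : Config N → ℝ}
    (hh : Measurable h) :
    ∫ ω, h (worldLine X ω t) ∂wienerPaths N =
      ∫ Y : Config N, (∏ i, ∏ k, gaussianPDFReal (X i k) (2 * t) (Y i k)) * h Y := by
  rw [← integral_map (measurable_worldLine X t).aemeasurable hh.aestronglyMeasurable,
    map_worldLine X ht,
    integral_withDensity_eq_integral_toReal_smul (measurable_heatKernel X t)
      (Eventually.of_forall fun Y => ?_)]
  · simp_rw [toReal_heatKernel, smul_eq_mul]
  · exact ENNReal.prod_lt_top fun i _ => ENNReal.prod_lt_top fun k _ => gaussianPDF_lt_top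

/-- **`∫ p(2t; X, Y) dY = 1`** (real heat kernel, `t > 0`). [folklore] -/
theorem integral_heatKernelReal (X : Config N) {t : ℝ≥0} (ht : t ≠ 0) :
    ∫ Y : Config N, (∏ i, ∏ k, gaussianPDFReal (X i k) (2 * t) (Y i k)) = 1 := by
  have h := integral_worldLine_eq X ht (h := fun _ => (1 : ℝ)) measurable_const
  simp only [mul_one] at h
  rw [← h, integral_const, smul_eq_mul, mul_one, probReal_univ]

/-- The real heat kernel is integrable in `Y` (`t > 0`). [folklore] -/
theorem integrable_heatKernelReal (X : Config N) {t : ℝ≥0} (ht : t ≠ 0) :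
    Integrable (fun Y : Config N => ∏ i, ∏ k, gaussianPDFReal (X i k) (2 * t) (Y i k)) := by
  by_contra hni
  have h1 := integral_heatKernelReal X ht
  rw [integral_undef hni] at h1
  exact zero_ne_one h1

/-- A bounded measurable observable is integrable against the heat kernel. [folklore] -/
theorem integrable_heatKernelReal_mul (X : Config N) {t : ℝ≥0} (ht : t ≠ 0) {h : Config N → ℝ}
    (hh : Measurable h) {K : ℝ} (hK : ∀ Y, |h Y| ≤ K) :
    Integrable (fun Y : Config N => (∏ i, ∏ k, gaussianPDFReal (X i k) (2 * t) (Y i k)) * h Y) := by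
  refine ((integrable_heatKernelReal X ht).mul_const K).mono'
    ((measurable_heatKernelReal X t).mul hh).aestronglyMeasurable (Eventually.of_forall fun Y => ?_)
  rw [Real.norm_eq_abs, abs_mul, abs_of_nonneg (heatKernelReal_nonneg X Y t)]
  exact mul_le_mul_of_nonneg_left (hK Y) (heatKernelReal_nonneg X Y t)

/-! ### Translation continuity of the heat kernel in `L¹` (Scheffé) -/

/-- Translating both arguments: `p(2t; X, Y) = p(2t; 0, Y - X)`. [folklore] -/
theorem heatKernelReal_eq_sub (X Y : Config N) (t : ℝ≥0) :
    (∏ i, ∏ k, gaussianPDFReal (X i k) (2 * t) (Y i k)) =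
      ∏ i, ∏ k, gaussianPDFReal ((0 : Config N) i k) (2 * t) ((Y - X) i k) := by
  refine Finset.prod_congr rfl fun i _ => Finset.prod_congr rfl fun k _ => ?_
  simp only [gaussianPDFReal, Pi.zero_apply, PiLp.zero_apply, Pi.sub_apply, PiLp.sub_apply,
    sub_zero]

/-- **The `L¹` distance of two translates of the heat kernel only depends on the difference of
the base points**: `∫ |p(X, Y) - p(X', Y)| dY = ∫ |p(0, Y) - p(X' - X, Y)| dY`. [folklore] -/
theorem integral_abs_heatKernel_sub_eq (X X' : Config N) (t : ℝ≥0) :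
    ∫ Y : Config N, |(∏ i, ∏ k, gaussianPDFReal (X i k) (2 * t) (Y i k)) -
        ∏ i, ∏ k, gaussianPDFReal (X' i k) (2 * t) (Y i k)| =
      ∫ Y : Config N, |(∏ i, ∏ k, gaussianPDFReal ((0 : Config N) i k) (2 * t) (Y i k)) -
        ∏ i, ∏ k, gaussianPDFReal ((X' - X) i k) (2 * t) (Y i k)| := by
  rw [← integral_add_right_eq_self (μ := (volume : Measure (Config N))) _ X]
  refine integral_congr_ae (Eventually.of_forall fun Y => ?_)
  simp only
  rw [heatKernelReal_eq_sub X, heatKernelReal_eq_sub X', heatKernelReal_eq_sub (X' - X)]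
  have e1 : Y + X - X = Y - 0 := by simp
  have e2 : Y + X - X' = Y - (X' - X) := by abel
  rw [e1, e2, sub_zero]

/-- **Scheffé's lemma** (real, nonnegative version): if `F n → f` pointwise, `F n, f ≥ 0` are
integrable with `∫ F n = ∫ f`, then `∫ |f - F n| → 0` (dominated convergence for
`min(f, F n) ≤ f` and `|a - b| = a + b - 2 min(a, b)`). [folklore] -/
theorem tendsto_integral_abs_sub_of_integral_eq {α ι : Type*} [MeasurableSpace α]
    {μ : Measure α} {l : Filter ι} [l.IsCountablyGenerated] {F : ι → α → ℝ} {f : α → ℝ}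
    (hFm : ∀ n, Measurable (F n)) (hfm : Measurable f) (hF0 : ∀ n x, 0 ≤ F n x)
    (hf0 : ∀ x, 0 ≤ f x) (hfi : Integrable f μ) (hFi : ∀ n, Integrable (F n) μ)
    (hint : ∀ n, ∫ x, F n x ∂μ = ∫ x, f x ∂μ)
    (hlim : ∀ x, Tendsto (fun n => F n x) l (𝓝 (f x))) :
    Tendsto (fun n => ∫ x, |f x - F n x| ∂μ) l (𝓝 0) := by
  -- `∫ min(f, F n) → ∫ f`
  have hmi : ∀ n, Integrable (fun x => min (f x) (F n x)) μ := fun n =>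
    hfi.mono' (hfm.min (hFm n)).aestronglyMeasurable (Eventually.of_forall fun x => by
      rw [Real.norm_eq_abs, abs_of_nonneg (le_min (hf0 x) (hF0 n x))]
      exact min_le_left _ _)
  have hmin : Tendsto (fun n => ∫ x, min (f x) (F n x) ∂μ) l (𝓝 (∫ x, f x ∂μ)) := by
    refine tendsto_integral_filter_of_dominated_convergence (fun x => f x)
      (Eventually.of_forall fun n => (hfm.min (hFm n)).aestronglyMeasurable)
      (Eventually.of_forall fun n => Eventually.of_forall fun x => ?_) hfi
      (Eventually.of_forall fun x => ?_)
    · rw [Real.norm_eq_abs, abs_of_nonneg (le_min (hf0 x) (hF0 n x))]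
      exact min_le_left _ _
    · have := (continuous_min.tendsto (f x, f x)).comp (tendsto_const_nhds.prodMk_nhds (hlim x))
      simpa [Function.comp_def] using this
  -- `∫ |f - F n| = 2 ∫ f - 2 ∫ min(f, F n)`
  have heq : ∀ n, ∫ x, |f x - F n x| ∂μ = 2 * ∫ x, f x ∂μ - 2 * ∫ x, min (f x) (F n x) ∂μ := by
    intro n
    have hpt : ∀ x, |f x - F n x| = f x + F n x - 2 * min (f x) (F n x) := by
      intro x
      rcases le_total (f x) (F n x) with h | h
      · rw [min_eq_left h, abs_of_nonpos (sub_nonpos.2 h)]; ring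
      · rw [min_eq_right h, abs_of_nonneg (sub_nonneg.2 h)]; ring
    simp_rw [hpt]
    have hadd : Integrable (fun x => f x + F n x) μ := hfi.add (hFi n)
    have h2m : Integrable (fun x => 2 * min (f x) (F n x)) μ := (hmi n).const_mul 2
    rw [integral_sub hadd h2m, integral_add hfi (hFi n), integral_const_mul, hint n]
    ring
  simp_rw [heq]
  have h := (hmin.const_mul 2).const_sub (2 * ∫ x, f x ∂μ)
  rwa [sub_self] at h

/-- **Translation continuity of the heat kernel in `L¹`** (Scheffé):
`∫ |p(2t; 0, Y) - p(2t; Z, Y)| dY → 0` as `Z → 0` (`t > 0`). [folklore] -/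
theorem tendsto_integral_abs_heatKernel_sub {t : ℝ≥0} (ht : t ≠ 0) :
    Tendsto (fun Z : Config N => ∫ Y : Config N,
      |(∏ i, ∏ k, gaussianPDFReal ((0 : Config N) i k) (2 * t) (Y i k)) -
        ∏ i, ∏ k, gaussianPDFReal (Z i k) (2 * t) (Y i k)|) (𝓝 0) (𝓝 0) := by
  have hint : ∀ Z : Config N, ∫ Y : Config N, (∏ i, ∏ k, gaussianPDFReal (Z i k) (2 * t) (Y i k)) =
      ∫ Y : Config N, (∏ i, ∏ k, gaussianPDFReal ((0 : Config N) i k) (2 * t) (Y i k)) := fun Z => by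
    rw [integral_heatKernelReal Z ht, integral_heatKernelReal 0 ht]
  have hlim : ∀ Y : Config N, Tendsto (fun Z : Config N => ∏ i, ∏ k, gaussianPDFReal (Z i k) (2 * t) (Y i k))
      (𝓝 0) (𝓝 (∏ i, ∏ k, gaussianPDFReal ((0 : Config N) i k) (2 * t) (Y i k))) := fun Y => by
    have hc : Continuous fun p : Config N × Config N =>
        ∏ i, ∏ k, gaussianPDFReal (p.1 i k) (2 * t) (p.2 i k) := continuous_heatKernelReal_uncurry t
    have h2 : Continuous fun Z : Config N => (Z, Y) := continuous_id.prodMk continuous_const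
    exact (hc.comp h2).tendsto 0
  exact tendsto_integral_abs_sub_of_integral_eq (μ := volume) (l := 𝓝 (0 : Config N))
    (F := fun (Z Y : Config N) => ∏ i, ∏ k, gaussianPDFReal (Z i k) (2 * t) (Y i k))
    (f := fun Y : Config N => ∏ i, ∏ k, gaussianPDFReal ((0 : Config N) i k) (2 * t) (Y i k))
    (fun Z => measurable_heatKernelReal Z t) (measurable_heatKernelReal 0 t)
    (fun Z Y => heatKernelReal_nonneg Z Y t) (fun Y => heatKernelReal_nonneg 0 Y t)
    (integrable_heatKernelReal 0 ht) (fun Z => integrable_heatKernelReal Z ht) hint hlim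

/-- **Uniform modulus of continuity of the free semigroup on bounded observables** (strong
Feller property of Brownian motion): for measurable `h` with `|h| ≤ K` and `t > 0`,
`|E[h(X + √2 b_t)] - E[h(X' + √2 b_t)]| ≤ K ∫ |p(2t; X, ·) - p(2t; X', ·)|`. Chung–Zhao (1995),
Thm 2.2 / Prop 3.12. [cite: ChungZhao1995, Thm 2.2] -/
theorem abs_integral_worldLine_sub_le (X X' : Config N) {t : ℝ≥0} (ht : t ≠ 0) {h : Config N → ℝ}
    (hh : Measurable h) {K : ℝ} (hK : ∀ Y, |h Y| ≤ K) :
    |∫ ω, h (worldLine X ω t) ∂wienerPaths N - ∫ ω, h (worldLine X' ω t) ∂wienerPaths N| ≤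
      K * ∫ Y : Config N, |(∏ i, ∏ k, gaussianPDFReal (X i k) (2 * t) (Y i k)) -
        ∏ i, ∏ k, gaussianPDFReal (X' i k) (2 * t) (Y i k)| := by
  rw [integral_worldLine_eq X ht hh, integral_worldLine_eq X' ht hh,
    ← integral_sub (integrable_heatKernelReal_mul X ht hh hK) (integrable_heatKernelReal_mul X' ht hh hK)]
  have hK0 : 0 ≤ K := (abs_nonneg _).trans (hK 0)
  calc |∫ Y : Config N, (∏ i, ∏ k, gaussianPDFReal (X i k) (2 * t) (Y i k)) * h Y -
        (∏ i, ∏ k, gaussianPDFReal (X' i k) (2 * t) (Y i k)) * h Y|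
      ≤ ∫ Y : Config N, |(∏ i, ∏ k, gaussianPDFReal (X i k) (2 * t) (Y i k)) * h Y -
        (∏ i, ∏ k, gaussianPDFReal (X' i k) (2 * t) (Y i k)) * h Y| := abs_integral_le_integral_abs
    _ ≤ ∫ Y : Config N, K * |(∏ i, ∏ k, gaussianPDFReal (X i k) (2 * t) (Y i k)) -
        ∏ i, ∏ k, gaussianPDFReal (X' i k) (2 * t) (Y i k)| := by
        refine integral_mono_of_nonneg (Eventually.of_forall fun Y => abs_nonneg _) ?_
          (Eventually.of_forall fun Y => ?_)
        · exact (((integrable_heatKernelReal X ht).sub (integrable_heatKernelReal X' ht)).abs).const_mul K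
        · dsimp only
          rw [← sub_mul, abs_mul, mul_comm]
          exact mul_le_mul_of_nonneg_right (hK Y) (abs_nonneg _)
    _ = _ := integral_const_mul _ _

/-! ### Exit probabilities -/

/-- If every coordinate satisfies `|b_u(i,k)| ≤ r/√6` then the displacement `√2 b_u` has
sup-norm `≤ r` (`‖√2 b_u(i, ·)‖₂² = ∑ₖ 2 b² ≤ 3 · r²/3`). [folklore] -/
theorem norm_displacement_le {r : ℝ} (hr : 0 ≤ r) (ω : PathSpace N) (u : ℝ≥0)
    (h : ∀ i k, |brownian u (ω i k)| ≤ r / Real.sqrt 6) :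
    ‖(fun i : Fin N => WithLp.toLp 2 (fun k : Fin 3 => Real.sqrt 2 * brownian u (ω i k)) :
      Config N)‖ ≤ r := by
  refine (pi_norm_le_iff_of_nonneg hr).2 fun i => ?_
  rw [EuclideanSpace.norm_eq]
  have h6 : Real.sqrt 6 ^ 2 = 6 := Real.sq_sqrt (by norm_num)
  have hterm : ∀ k : Fin 3,
      ‖(WithLp.toLp 2 (fun k : Fin 3 => Real.sqrt 2 * brownian u (ω i k)) : Space) k‖ ^ 2 ≤
        r ^ 2 / 3 := by
    intro k
    rw [PiLp.toLp_apply, Real.norm_eq_abs, sq_abs, mul_pow, Real.sq_sqrt (by norm_num)]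
    have hb2 : brownian u (ω i k) ^ 2 ≤ (r / Real.sqrt 6) ^ 2 := by
      rw [← sq_abs]
      exact pow_le_pow_left₀ (abs_nonneg _) (h i k) 2
    rw [div_pow, h6] at hb2
    linarith
  calc Real.sqrt (∑ k, ‖(WithLp.toLp 2 (fun k : Fin 3 => Real.sqrt 2 * brownian u (ω i k)) :
        Space) k‖ ^ 2)
      ≤ Real.sqrt (∑ _k : Fin 3, r ^ 2 / 3) := Real.sqrt_le_sqrt (Finset.sum_le_sum fun k _ => hterm k)
    _ = r := by
        rw [Finset.sum_const, Finset.card_univ, Fintype.card_fin]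
        have : (3 : ℕ) • (r ^ 2 / 3) = r ^ 2 := by rw [nsmul_eq_mul]; push_cast; ring
        rw [this, Real.sqrt_sq hr]

/-- **Exit before time `s` forces a large coordinate excursion**: if the closed `r`-ball around the
starting point lies in the open box and the world-lines do not survive up to `s`, then some
Brownian coordinate reaches `r/√6` in absolute value before `s`. [folklore] -/
theorem exists_abs_brownian_ge_of_not_survives (L : ℝ) (s : ℝ≥0) {X : Config N} {r : ℝ}
    (hr : 0 < r) (hX : Metric.closedBall X r ⊆ boxN N L) {ω : PathSpace N}
    (hω : ω ∉ survives L s X) :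
    ∃ i k, ∃ u ≤ s, r / Real.sqrt 6 ≤ |brownian u (ω i k)| := by
  simp only [survives, Set.mem_setOf_eq, not_forall, exists_prop] at hω
  obtain ⟨t', ht', hnot⟩ := hω
  have hdist : r < dist (worldLine X ω t'.toNNReal) X := by
    by_contra hle
    exact hnot (hX (Metric.mem_closedBall.2 (not_lt.1 hle)))
  rw [dist_eq_norm, worldLine_eq_add, add_sub_cancel_left] at hdist
  by_contra hcon
  have hle := norm_displacement_le hr.le ω t'.toNNReal fun i k => by
    by_contra hgt
    exact hcon ⟨i, k, t'.toNNReal, Real.toNNReal_le_iff_le_coe.2 ht'.2, (not_le.1 hgt).le⟩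
  exact absurd (hdist.trans_le hle) (lt_irrefl r)

/-- **Exit probability bound**: from a starting point whose closed `r`-ball lies in the open box,
the probability of not surviving up to time `s` is at most `3N` one-dimensional tails
`P(∃ u ≤ s, r/√6 ≤ |b_u|)`. [folklore] -/
theorem measure_not_survives_le (L : ℝ) (s : ℝ≥0) {X : Config N} {r : ℝ} (hr : 0 < r)
    (hX : Metric.closedBall X r ⊆ boxN N L) :
    wienerPaths N (survives L s X)ᶜ ≤
      ∑ _i : Fin N, ∑ _k : Fin 3, preWienerMeasure {η | ∃ u ≤ s, r / Real.sqrt 6 ≤ |brownian u η|} := by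
  haveI := Literature.Probability.RandomPlanarGeometry.isProbabilityMeasure_preWienerMeasure'
  set S : Set (ℝ≥0 → ℝ) := {η | ∃ u ≤ s, r / Real.sqrt 6 ≤ |brownian u η|} with hS
  have hsub : (survives L s X)ᶜ ⊆ ⋃ i : Fin N, ⋃ k : Fin 3, (fun ω : PathSpace N => ω i k) ⁻¹' S := by
    intro ω hω
    obtain ⟨i, k, u, hu, hge⟩ := exists_abs_brownian_ge_of_not_survives L s hr hX hω
    simp only [Set.mem_iUnion, Set.mem_preimage, hS, Set.mem_setOf_eq]
    exact ⟨i, k, u, hu, hge⟩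
  have hmp : ∀ (i : Fin N) (k : Fin 3), MeasurePreserving (fun ω : PathSpace N => ω i k)
      (wienerPaths N) preWienerMeasure := fun i k =>
    (measurePreserving_eval (μ := fun _ : Fin 3 => preWienerMeasure) k).comp
      (measurePreserving_eval (μ := fun _ : Fin N => Measure.pi fun _ : Fin 3 => preWienerMeasure) i)
  calc wienerPaths N (survives L s X)ᶜ
      ≤ wienerPaths N (⋃ i : Fin N, ⋃ k : Fin 3, (fun ω : PathSpace N => ω i k) ⁻¹' S) :=
        measure_mono hsub
    _ ≤ ∑ i : Fin N, wienerPaths N (⋃ k : Fin 3, (fun ω : PathSpace N => ω i k) ⁻¹' S) :=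
        measure_iUnion_fintype_le _ _
    _ ≤ ∑ i : Fin N, ∑ k : Fin 3, wienerPaths N ((fun ω : PathSpace N => ω i k) ⁻¹' S) :=
        Finset.sum_le_sum fun i _ => measure_iUnion_fintype_le _ _
    _ ≤ ∑ _i : Fin N, ∑ _k : Fin 3, preWienerMeasure S := by
        refine Finset.sum_le_sum fun i _ => Finset.sum_le_sum fun k _ => ?_
        have h := Measure.le_map_apply (hmp i k).measurable.aemeasurable S (μ := wienerPaths N)
        rwa [(hmp i k).map_eq] at h

/-- **The one-dimensional tail is `O(s²)`**: `P(∃ u ≤ s, a ≤ |b_u|) ≤ 2s²/(a² - s)²` for `s < a²`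
(the tree's `measure_exists_le_abs_brownian_le`, Revuz–Yor II (1.7)); in particular it tends to
`0` as `s → 0⁺`. [folklore] -/
theorem tendsto_tail_zero {a : ℝ} (ha : 0 < a) :
    Tendsto (fun s : ℝ≥0 => preWienerMeasure {η | ∃ u ≤ s, a ≤ |brownian u η|}) (𝓝 0) (𝓝 0) := by
  -- squeeze between `0` and `ofReal (2 s² / (a² - s)²)` near `0`
  have hbound : ∀ᶠ s : ℝ≥0 in 𝓝 0, preWienerMeasure {η | ∃ u ≤ s, a ≤ |brownian u η|} ≤
      ENNReal.ofReal (2 * (s : ℝ) ^ 2 / (a ^ 2 - s) ^ 2) := by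
    have h : ∀ᶠ s : ℝ≥0 in 𝓝 0, (s : ℝ) < a ^ 2 := by
      have hc : Continuous fun s : ℝ≥0 => (s : ℝ) := NNReal.continuous_coe
      exact hc.tendsto 0 |>.eventually (gt_mem_nhds (by simpa using pow_pos ha 2))
    filter_upwards [h] with s hs
    exact measure_exists_le_abs_brownian_le s ha.le hs
  have hlim : Tendsto (fun s : ℝ≥0 => ENNReal.ofReal (2 * (s : ℝ) ^ 2 / (a ^ 2 - s) ^ 2)) (𝓝 0) (𝓝 0) := by
    have hc : ContinuousAt (fun s : ℝ => 2 * s ^ 2 / (a ^ 2 - s) ^ 2) 0 := by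
      refine ContinuousAt.div (by fun_prop) (by fun_prop) ?_
      simpa using (pow_pos ha 2).ne'
    have h2 : Tendsto (fun s : ℝ≥0 => 2 * (s : ℝ) ^ 2 / (a ^ 2 - s) ^ 2) (𝓝 0) (𝓝 0) := by
      have := hc.tendsto.comp (NNReal.continuous_coe.tendsto 0)
      simpa [Function.comp_def] using this
    rw [← ENNReal.ofReal_zero]
    exact ENNReal.tendsto_ofReal h2
  exact tendsto_of_tendsto_of_tendsto_of_le_of_le' tendsto_const_nhds hlim
    (Eventually.of_forall fun _ => bot_le) hbound

/-! ### Weight defects for bounded pair potentials -/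

/-- `e^{-·}` on `[0, ∞]` is antitone. [folklore] -/
theorem expNeg_antitone {a b : ℝ≥0∞} (h : a ≤ b) : expNeg b ≤ expNeg a := by
  unfold expNeg
  rcases eq_or_ne b ∞ with rfl | hb
  · simp
  · have ha : a ≠ ∞ := ne_top_of_le_ne_top hb h
    rw [if_neg hb, if_neg ha]
    exact ENNReal.ofReal_le_ofReal (Real.exp_le_exp.2 (neg_le_neg ((ENNReal.toReal_le_toReal ha hb).2 h)))

/-- A bounded pair potential gives a bounded interaction: `∑_{i<j} v ≤ N² C`. [folklore] -/
theorem interaction_le_of_le {v : ℝ → ℝ≥0∞} {C : ℝ≥0∞} (hC : ∀ r, v r ≤ C) (X : Config N) :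
    interaction v X ≤ (N * N : ℕ) * C := by
  unfold interaction
  calc ∑ i : Fin N, ∑ j ∈ Finset.univ.filter (fun j => i < j), v (dist (X i) (X j))
      ≤ ∑ _i : Fin N, ∑ _j : Fin N, C := by
        refine Finset.sum_le_sum fun i _ => ?_
        exact (Finset.sum_le_sum fun j _ => hC _).trans
          (Finset.sum_le_sum_of_subset_of_nonneg (Finset.filter_subset _ _) fun _ _ _ => bot_le)
    _ = (N * N : ℕ) * C := by
        simp only [Finset.sum_const, Finset.card_univ, Fintype.card_fin, Nat.cast_mul, nsmul_eq_mul]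
        ring

/-- The action up to time `s ≥ 0` is at most `N² C s` for `v ≤ C`. [folklore] -/
theorem pathAction_le_of_le {v : ℝ → ℝ≥0∞} {C : ℝ≥0∞} (hC : ∀ r, v r ≤ C) (s : ℝ)
    (X : Config N) (ω : PathSpace N) :
    pathAction v s X ω ≤ (N * N : ℕ) * C * ENNReal.ofReal s := by
  unfold pathAction
  calc ∫⁻ r in Set.Ioc (0 : ℝ) s, interaction v (worldLine X ω r.toNNReal)
      ≤ ∫⁻ _r in Set.Ioc (0 : ℝ) s, (N * N : ℕ) * C := lintegral_mono fun r => interaction_le_of_le hC _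
    _ = (N * N : ℕ) * C * ENNReal.ofReal s := by
        rw [setLIntegral_const, Real.volume_Ioc, sub_zero]

/-- **Weight defect for a bounded pair potential**: `1 - w_s(X, ω) ≤ 𝟙{τ ≤ s}(ω) + N² C s`
(`v ≤ C`, `s ≥ 0`): a surviving path has weight `e^{-∫₀ˢ V} ≥ e^{-N²Cs} ≥ 1 - N² C s`. [folklore] -/
theorem one_sub_toReal_fkWeight_le {v : ℝ → ℝ≥0∞} {C : ℝ≥0} (hC : ∀ r, v r ≤ C) (L : ℝ) {s : ℝ}
    (hs : 0 ≤ s) (X : Config N) (ω : PathSpace N) :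
    1 - (fkWeight v L s X ω).toReal ≤
      (survives L s X)ᶜ.indicator (fun _ => (1 : ℝ)) ω + (N * N : ℕ) * C * s := by
  have hNCs : 0 ≤ (N * N : ℕ) * (C : ℝ) * s := by positivity
  by_cases hω : ω ∈ survives L s X
  · rw [Set.indicator_of_notMem (Set.notMem_compl_iff.mpr hω), zero_add, fkWeight, Set.indicator_of_mem hω]
    -- `w = expNeg (action) ≥ expNeg (N² C s)`
    have hA : pathAction v s X ω ≤ (N * N : ℕ) * (C : ℝ≥0∞) * ENNReal.ofReal s :=
      pathAction_le_of_le (C := (C : ℝ≥0∞)) (fun r => hC r) s X ω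
    have hM : ((N * N : ℕ) * (C : ℝ≥0∞) * ENNReal.ofReal s) ≠ ⊤ :=
      ENNReal.mul_ne_top (ENNReal.mul_ne_top (ENNReal.natCast_ne_top _) ENNReal.coe_ne_top)
        ENNReal.ofReal_ne_top
    have hw : (expNeg ((N * N : ℕ) * (C : ℝ≥0∞) * ENNReal.ofReal s)).toReal ≤
        (expNeg (pathAction v s X ω)).toReal :=
      ENNReal.toReal_mono ((expNeg_le_one _).trans_lt ENNReal.one_lt_top).ne (expNeg_antitone hA)
    have hexp : (expNeg ((N * N : ℕ) * (C : ℝ≥0∞) * ENNReal.ofReal s)).toReal =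
        Real.exp (-((N * N : ℕ) * C * s)) := by
      rw [expNeg, if_neg hM, ENNReal.toReal_ofReal (Real.exp_pos _).le]
      congr 2
      rw [ENNReal.toReal_mul, ENNReal.toReal_mul, ENNReal.toReal_ofReal hs]
      simp
    rw [hexp] at hw
    have h1 : 1 - (N * N : ℕ) * (C : ℝ) * s ≤ Real.exp (-((N * N : ℕ) * C * s)) := by
      have := Real.add_one_le_exp (-((N * N : ℕ) * (C : ℝ) * s))
      linarith
    linarith
  · rw [Set.indicator_of_mem (show ω ∈ (survives L s X)ᶜ from hω), fkWeight,
      Set.indicator_of_notMem hω]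
    simp only [ENNReal.toReal_zero, sub_zero]
    linarith

/-- **Expected weight defect**: `E[1 - w_s(X, ·)] ≤ P(τ ≤ s) + N² C s` (`v ≤ C`, `s ≥ 0`).
[folklore] -/
theorem integral_one_sub_fkWeight_le {v : ℝ → ℝ≥0∞} {C : ℝ≥0} (hC : ∀ r, v r ≤ C)
    (L : ℝ) {s : ℝ} (hs : 0 ≤ s) (X : Config N) :
    ∫ ω, (1 - (fkWeight v L s X ω).toReal) ∂wienerPaths N ≤
      (wienerPaths N (survives L s X)ᶜ).toReal + (N * N : ℕ) * C * s := by
  have hint : Integrable (fun ω : PathSpace N =>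
      (survives L s X)ᶜ.indicator (fun _ => (1 : ℝ)) ω + (N * N : ℕ) * C * s) (wienerPaths N) :=
    ((integrable_const 1).indicator (measurableSet_survives L s X).compl).add (integrable_const _)
  calc ∫ ω, (1 - (fkWeight v L s X ω).toReal) ∂wienerPaths N
      ≤ ∫ ω, ((survives L s X)ᶜ.indicator (fun _ => (1 : ℝ)) ω + (N * N : ℕ) * C * s)
          ∂wienerPaths N := by
        refine integral_mono_of_nonneg (Eventually.of_forall fun ω => ?_) hint
          (Eventually.of_forall fun ω => one_sub_toReal_fkWeight_le hC L hs X ω)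
        have := fkWeight_le_one v L s X ω
        have h1 : (fkWeight v L s X ω).toReal ≤ 1 := by
          have := ENNReal.toReal_mono ENNReal.one_ne_top this
          simpa using this
        simp only [Pi.zero_apply]
        linarith
    _ = (wienerPaths N (survives L s X)ᶜ).toReal + (N * N : ℕ) * C * s := by
        rw [integral_add ((integrable_const 1).indicator (measurableSet_survives L s X).compl)
          (integrable_const _), integral_indicator (measurableSet_survives L s X).compl,
          setIntegral_const, integral_const, smul_eq_mul, mul_one, probReal_univ, smul_eq_mul, one_mul,
          measureReal_def]

/-- **The `L² → L^∞` constant is antitone in time**: for `0 < t₀ ≤ t`,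
`(4πt)^{-3N/4} ≤ (4πt₀)^{-3N/4}`. [folklore] -/
theorem heatConst_antitone {t₀ t : ℝ} (ht₀ : 0 < t₀) (h : t₀ ≤ t) :
    (∏ _i : Fin N, ∏ _k : Fin 3, ENNReal.ofReal (Real.sqrt (2 * Real.pi * (2 * t.toNNReal)))⁻¹) ^
        (1 / 2 : ℝ) ≤
      (∏ _i : Fin N, ∏ _k : Fin 3, ENNReal.ofReal (Real.sqrt (2 * Real.pi * (2 * t₀.toNNReal)))⁻¹) ^
        (1 / 2 : ℝ) := by
  refine ENNReal.rpow_le_rpow ?_ (by norm_num)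
  refine Finset.prod_le_prod' fun i _ => Finset.prod_le_prod' fun k _ => ?_
  refine ENNReal.ofReal_le_ofReal (inv_anti₀ (Real.sqrt_pos.2 ?_) (Real.sqrt_le_sqrt ?_))
  · have : (0 : ℝ) < t₀.toNNReal := by simpa using ht₀
    positivity
  · have h' : (t₀.toNNReal : ℝ) ≤ t.toNNReal := by
      rw [Real.coe_toNNReal _ ht₀.le, Real.coe_toNNReal _ (ht₀.le.trans h)]
      exact h
    nlinarith [Real.pi_pos]

end Literature.MathematicalPhysics.QuantumManyBody.BoseGas

end
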